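import Summits.QuantumFields.YangMills.Theorems.LuscherReductionTwistedTraceScalingVacuumHodge
import Summits.QuantumFields.YangMills.Theorems.LuscherReductionTwistedTraceScalingOrthoTubeCoords
import Summits.QuantumFields.YangMills.Theorems.LuscherReductionTwistedTraceScalingBTTailKernel
import Summits.QuantumFields.YangMills.Theorems.LuscherReductionTwistedTraceScalingBOCentralChart
import Summits.QuantumFields.YangMills.Theorems.TwistedTraceScaling.Negative.FlatProximityQuartic
import Summits.QuantumFields.YangMills.Theorems.TwistedTraceScaling.Negative.StiffSeparationLeak
import HarnessLib


/-!
# R56B (crux `TwistedTraceScaling`, stmt-QuantumFields-20203): the `L = 2` PURE-GAUGE WITNESS for stiff separation — gauge copies of the profile centre have ZERO kinetic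
# defect and a QUARTIC stiff chart component `‖P_s x'‖² ≥ ‖x'‖⁴/8192`; hence no slack-free stiff-separation inequality on the chart ball, and the forced slack

Standing disprover `ym-cdisprove-20203-1` (gen 45); companion of R56 (`…Negative.StiffSeparationLeak`: the `[u_k − 1, ξ]` cross term is a constant mode plus an `O(τ)` leak
controlled by the field's own gauge component; linearised stiff separation in the vacuum split).  This file is the NECESSITY side of the answer to lane A's `disprover-wanted`
(COARSE-DESIGN §30.6 (d), `ym-luscher-20007-p1` g19): which slack a stiff-separation inequality `kinDefect(oT u x', oT u x, g) ≥ c‖P_s(x' − x)‖² − δ` MUST carry.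
* §4 ★★ the witness (exact, `L = 2`, `u = 1`): `g_x = a^{[x₀=1]} b^{[x₁=1]}` with `q(a) = (cos φ, sin φ, 0, 0)`, `q(b) = (cos φ, 0, sin φ, 0)`, chart field
  `x'_{(x,k)} = u⃗(g_x g_{x+k}⁻¹)`: balanced (`pureGauge_mem_balancedSet_two` — EVERY pure gauge is balanced at `L = 2`, by the involution `x ↦ x + k`), capped for
  `sin²φ ≤ 1/4`, `oT 1 x' = 1^g` for `cos φ ≥ 0` (`witness_orthoTube_eq`), ZERO kinetic defect against the centre `oT 1 0 = 1` (`kinDefect_gaugeTransform_self`,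
  `witness_kinDefect_eq_zero`), zero Wilson action, honest chart coordinates (slow mean `1`, `relLinkVec = linkEmbed x'`), chart radius `‖x'‖² = 16 sin²φ`
  (`witness_norm_sq`), and ONE explicit curl component `(d x')_{(0; 0<1), colour 2} = −2 cos φ sin²φ` (`witness_curl_component` — the BCH commutator of the two axis
  rotations: the chart field of a pure gauge is curl-free only to first order) ⇒ with `‖d v‖² ≤ 96‖P_s v‖²` (`R56.norm_covCurl_one_sq_le_stiffProj`):
  `‖P_s x'‖² ≥ sin⁴φ/32 = ‖x'‖⁴/8192` (`witness_stiffProj_sq_ge`; numerically the stiff component is `‖x'‖⁴/64` exactly).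
* §5 ★★★ NEGATIVE THEOREMS: `not_slackFree_stiffSeparation_two` — there is no `c > 0` with `kinDefect(oT 1 x', oT 1 x, g) ≥ c·‖P_s(x' − x)‖²` for all capped balanced
  `x, x'` and all gauge fields `g`; `slack_ge_of_stiffSeparation_two` — a version with slack `δ` forces `δ ≥ c·sin⁴φ/32` for every `cos φ ≥ 0`, `sin²φ ≤ 1/4`, i.e.
  `δ ≥ c·‖x'‖⁴/8192` along the family; `exists_pureGauge_witness_two` packages the family.  READ AT LANE A's SCALES: on the GAUGE-FAR far region (`‖x'‖ ≍ β^{-s}`,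
  `‖P_Γ x'‖ ≍ ‖x'‖`) the forced slack is `≍ β^{-4s} ≫ β^{-1}` for `s < 1/4`, so step (d) cannot hold there with an `o(β^{-1})` error — it must (and in COARSE-DESIGN §30.6 does)
  stay restricted to GAUGE-NEAR `U` (`‖P_Γ x'‖ ≤ β^{-1}ℓ`, where the same mechanism costs only `(β^{-1}ℓ)⁴`), the gauge-far part being carried by `χ ≤ e^{−ℓ²}`.
HONEST FRAMING: tightness lemmas for a stub ((C5)(d) of `COARSE-DESIGN §30`) of a child of the CONDITIONAL reduction route R2b1 (`LuscherReduction`, skeleton «twolattice»);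
no verdict on `TwistedTraceScaling` changes; not a gap, not Clay.  bears_on R2b1.  Exact numerics of the witness: session folder `num/witness_L2.py`.
-/

set_option autoImplicit false

noncomputable section

open Real
open scoped BigOperators InnerProductSpace RealInnerProductSpace Quaternion Matrix
open Literature.MathematicalPhysics.QuantumFieldTheory hiding SU2
open Literature.MathematicalPhysics.QuantumLattice
open Summit.QuantumFields.YangMills.Theorems.FemtoTransferGap
open Summit.QuantumFields.YangMills.Theorems.FemtoTransferGap.TwoLattice
open Summit.QuantumFields.YangMills.Theorems.FemtoTransferGap.TwoLattice.Stiff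
open Summit.QuantumFields.YangMills.Theorems.FemtoTransferGap.TwoLattice.Toron
open Summit.QuantumFields.YangMills.Theorems.FemtoTransferGap.TwoLattice.Cov
open Summit.QuantumFields.YangMills.Theorems.FemtoTransferGap.TwoLattice.ConstTube
open Summit.QuantumFields.YangMills.Theorems.TwistedTraceScaling.Negative

namespace Summit.QuantumFields.YangMills.Theorems.TwistedTraceScaling.Negative.R56B

variable {L : ℕ} [NeZero L]

/-! ## §4 The `L = 2` pure-gauge witness: zero kinetic defect against the profile centre, stiff chart component `≍ ‖x'‖²` -/

/-- ★ **A gauge copy has zero kinetic defect against its source**: `kinDefect(V^g, V, g) = 0`. [cite: Luscher1983, §3] -/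
theorem kinDefect_gaugeTransform_self (V : GaugeConfig 3 L SU2) (g : Site 3 L → SU2) :
    kinDefect L (gaugeTransform g V) V g = 0 := by
  unfold kinDefect
  refine Finset.sum_eq_zero fun e _ => ?_
  have h : su2Quat (gaugeTransform g V e) * su2Quat (g (e.1.shift e.2)) = su2Quat (g e.1) * su2Quat (V e) := by
    rw [← Balaban1983to89.T4HaarSU2Translate.su2Quat_mul, ← Balaban1983to89.T4HaarSU2Translate.su2Quat_mul]
    congr 1
    simp [gaugeTransform, mul_assoc]
  rw [h, sub_self, norm_zero]; norm_num

omit [NeZero L] in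
/-- `oT 1 0 = 1`: the profile CENTRE in chart coordinates. [folklore] -/
theorem orthoTube_one_zero : orthoTube L 1 (0 : Edge 3 L → Fin 3 → ℝ) = 1 := by
  funext e; rw [orthoTube_apply, Pi.zero_apply, chartSU2_zero']; simp

/-- On the `2`-torus every shift is an involution. [folklore] -/
theorem shift_shift_two (x : Site 3 2) (k : Fin 3) : (x.shift k).shift k = x := by
  have h2 : (1 : ZMod 2) + 1 = 0 := by decide
  simp only [Site.shift, add_assoc, ← Pi.single_add, h2, Pi.single_zero, add_zero]

/-- ★ **Pure gauges are balanced at `L = 2`**: for every `g : Site → SU(2)` the chart field `x'_{(x,k)} = u⃗(g_x g_{x+k}⁻¹)` of the pure gauge `1^g` has zero sum in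
every direction and colour (the involution `x ↦ x + k` pairs each link value with its inverse, `u⃗(W⁻¹) = −u⃗(W)`). [folklore] -/
theorem pureGauge_mem_balancedSet_two (g : Site 3 2 → SU2) :
    (fun e : Edge 3 2 => vecPart (g e.1 * (g (e.1.shift e.2))⁻¹)) ∈ balancedSet 2 := by
  intro k c
  show ∑ x : Site 3 2, vecPart (g x * (g (x.shift k))⁻¹) c = 0
  have hre : ∑ x : Site 3 2, vecPart (g (x.shift k) * (g ((x.shift k).shift k))⁻¹) c = ∑ x : Site 3 2, vecPart (g x * (g (x.shift k))⁻¹) c := by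
    refine Fintype.sum_equiv (Equiv.addRight (Pi.single k (1 : ZMod 2)))
      (fun x : Site 3 2 => vecPart (g (x.shift k) * (g ((x.shift k).shift k))⁻¹) c) (fun x : Site 3 2 => vecPart (g x * (g (x.shift k))⁻¹) c) (fun x => ?_)
    simp only [Equiv.coe_addRight, Site.shift]
  have hneg : ∀ x : Site 3 2, vecPart (g (x.shift k) * (g ((x.shift k).shift k))⁻¹) c = -vecPart (g x * (g (x.shift k))⁻¹) c := fun x => by
    rw [shift_shift_two, show g (x.shift k) * (g x)⁻¹ = (g x * (g (x.shift k))⁻¹)⁻¹ by rw [mul_inv_rev, inv_inv], vecPart_inv, Pi.neg_apply]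
  rw [Finset.sum_congr rfl fun x _ => hneg x, Finset.sum_neg_distrib] at hre
  linarith

/-- Shift arithmetic on the `2`-torus, direction `0`. [folklore] -/
theorem shift_apply_two (x : Site 3 2) (k j : Fin 3) : (x.shift k) j = x j + if j = k then 1 else 0 := by
  simp only [Site.shift, Pi.add_apply, Pi.single_apply]

/-- The direction-`0` links of the witness: `g_x g_{x+e₀}⁻¹ = a^{∓1}`. [folklore] -/
theorem witness_link0 {a b : SU2} {g : Site 3 2 → SU2} (hg : ∀ x, g x = (if x 0 = 0 then 1 else a) * (if x 1 = 0 then 1 else b)) (x : Site 3 2) :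
    g x * (g (x.shift 0))⁻¹ = if x 0 = 0 then a⁻¹ else a := by
  have h11 : (1 : ZMod 2) + 1 = 0 := by decide
  have h10 : (1 : ZMod 2) ≠ 0 := by decide
  rw [hg x, hg (x.shift 0), shift_apply_two, shift_apply_two]
  rcases (by decide : ∀ z : ZMod 2, z = 0 ∨ z = 1) (x 0) with h0 | h0 <;> rcases (by decide : ∀ z : ZMod 2, z = 0 ∨ z = 1) (x 1) with h1 | h1 <;> simp [h0, h1, h11, h10]

/-- The direction-`1` links of the witness: `g_x g_{x+e₁}⁻¹ = A b^{∓1} A⁻¹`, `A = g`'s `a`-factor at `x`. [folklore] -/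
theorem witness_link1 {a b : SU2} {g : Site 3 2 → SU2} (hg : ∀ x, g x = (if x 0 = 0 then 1 else a) * (if x 1 = 0 then 1 else b)) (x : Site 3 2) :
    g x * (g (x.shift 1))⁻¹ = (if x 0 = 0 then 1 else a) * (if x 1 = 0 then b⁻¹ else b) * (if x 0 = 0 then 1 else a)⁻¹ := by
  have h11 : (1 : ZMod 2) + 1 = 0 := by decide
  have h10 : (1 : ZMod 2) ≠ 0 := by decide
  rw [hg x, hg (x.shift 1), shift_apply_two, shift_apply_two]
  rcases (by decide : ∀ z : ZMod 2, z = 0 ∨ z = 1) (x 0) with h0 | h0 <;> rcases (by decide : ∀ z : ZMod 2, z = 0 ∨ z = 1) (x 1) with h1 | h1 <;> simp [h0, h1, h11, h10, mul_assoc]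

/-- The direction-`2` links of the witness are trivial. [folklore] -/
theorem witness_link2 {a b : SU2} {g : Site 3 2 → SU2} (hg : ∀ x, g x = (if x 0 = 0 then 1 else a) * (if x 1 = 0 then 1 else b)) (x : Site 3 2) :
    g x * (g (x.shift 2))⁻¹ = 1 := by
  have h20 : ((2 : Fin 3) : Fin 3) ≠ 0 := by decide
  have h21 : ((2 : Fin 3) : Fin 3) ≠ 1 := by decide
  rw [hg x, hg (x.shift 2), shift_apply_two, shift_apply_two, if_neg h20.symm, if_neg h21.symm, add_zero, add_zero, mul_inv_cancel]

/-- `u₀(a) = u₀(b) = cos φ` for the two axis rotations. [folklore] -/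
theorem scalarPart_of_quat {X : SU2} {r i j k : ℝ} (h : su2Quat X = ⟨r, i, j, k⟩) : scalarPart X = r := by
  simp only [scalarPart, h]

/-- The scalar parts of the witness links: `cos φ` in directions `0, 1`, `1` in direction `2`. [folklore] -/
theorem witness_scalarPart {a b : SU2} {φ : ℝ} (ha : su2Quat a = ⟨Real.cos φ, Real.sin φ, 0, 0⟩) (hb : su2Quat b = ⟨Real.cos φ, 0, Real.sin φ, 0⟩)
    {g : Site 3 2 → SU2} (hg : ∀ x, g x = (if x 0 = 0 then 1 else a) * (if x 1 = 0 then 1 else b)) (x : Site 3 2) (k : Fin 3) :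
    scalarPart (g x * (g (x.shift k))⁻¹) = if k = 2 then 1 else Real.cos φ := by
  have hsa := scalarPart_of_quat ha
  have hsb := scalarPart_of_quat hb
  rcases (by decide : ∀ k : Fin 3, k = 0 ∨ k = 1 ∨ k = 2) k with rfl | rfl | rfl
  · rw [witness_link0 hg, if_neg (show (0 : Fin 3) ≠ 2 by decide)]
    split_ifs
    · rw [scalarPart_inv, hsa]
    · exact hsa
  · rw [witness_link1 hg, scalarPart_conj, if_neg (show (1 : Fin 3) ≠ 2 by decide)]
    split_ifs
    · rw [scalarPart_inv, hsb]
    · exact hsb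
  · rw [witness_link2 hg, if_pos rfl, PolyakovLift.scalarPart_one]

/-- The squared chart coordinates of the witness links: `sin²φ` in directions `0, 1`, `0` in direction `2`. [folklore] -/
theorem witness_sum_sq {a b : SU2} {φ : ℝ} (ha : su2Quat a = ⟨Real.cos φ, Real.sin φ, 0, 0⟩) (hb : su2Quat b = ⟨Real.cos φ, 0, Real.sin φ, 0⟩)
    {g : Site 3 2 → SU2} (hg : ∀ x, g x = (if x 0 = 0 then 1 else a) * (if x 1 = 0 then 1 else b)) (x : Site 3 2) (k : Fin 3) :
    ∑ c, vecPart (g x * (g (x.shift k))⁻¹) c ^ 2 = if k = 2 then 0 else Real.sin φ ^ 2 := by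
  have h := scalarPart_sq_add (g x * (g (x.shift k))⁻¹)
  rw [witness_scalarPart ha hb hg] at h
  have hcs := Real.sin_sq_add_cos_sq φ
  split_ifs at h ⊢ <;> nlinarith

/-- ★ **The witness lies in the capped balanced chart ball** (`|sin φ| ≤ 1/2`). [folklore] -/
theorem witness_mem_capBalancedSet {a b : SU2} {φ : ℝ} (ha : su2Quat a = ⟨Real.cos φ, Real.sin φ, 0, 0⟩) (hb : su2Quat b = ⟨Real.cos φ, 0, Real.sin φ, 0⟩)
    (hs : Real.sin φ ^ 2 ≤ 1 / 4) {g : Site 3 2 → SU2} (hg : ∀ x, g x = (if x 0 = 0 then 1 else a) * (if x 1 = 0 then 1 else b)) :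
    (fun e : Edge 3 2 => vecPart (g e.1 * (g (e.1.shift e.2))⁻¹)) ∈ capBalancedSet 2 := by
  refine ⟨pureGauge_mem_balancedSet_two g, fun e => ?_⟩
  show ∑ c, vecPart (g e.1 * (g (e.1.shift e.2))⁻¹) c ^ 2 ≤ 1 / 4
  rw [witness_sum_sq ha hb hg]
  split_ifs <;> linarith

/-- ★ **The chart image of the witness is the pure gauge `1^g`** (all scalar parts are `≥ 0` for `cos φ ≥ 0`, so the orthographic chart inverts `u⃗`). [folklore] -/
theorem witness_orthoTube_eq {a b : SU2} {φ : ℝ} (ha : su2Quat a = ⟨Real.cos φ, Real.sin φ, 0, 0⟩) (hb : su2Quat b = ⟨Real.cos φ, 0, Real.sin φ, 0⟩)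
    (hc : 0 ≤ Real.cos φ) {g : Site 3 2 → SU2} (hg : ∀ x, g x = (if x 0 = 0 then 1 else a) * (if x 1 = 0 then 1 else b)) :
    orthoTube 2 1 (fun e : Edge 3 2 => vecPart (g e.1 * (g (e.1.shift e.2))⁻¹)) = gaugeTransform g 1 := by
  funext e
  rw [orthoTube_apply, Pi.one_apply, mul_one, chartSU2_vecPart]
  · simp [gaugeTransform]
  · rw [witness_scalarPart ha hb hg]; split_ifs; exacts [zero_le_one, hc]

/-- ★★ **ZERO kinetic defect**: the witness (a gauge copy of the profile centre `oT 1 0 = 1`) has `kinDefect(oT 1 x', oT 1 0, g) = 0`. [folklore] -/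
theorem witness_kinDefect_eq_zero {a b : SU2} {φ : ℝ} (ha : su2Quat a = ⟨Real.cos φ, Real.sin φ, 0, 0⟩) (hb : su2Quat b = ⟨Real.cos φ, 0, Real.sin φ, 0⟩)
    (hc : 0 ≤ Real.cos φ) {g : Site 3 2 → SU2} (hg : ∀ x, g x = (if x 0 = 0 then 1 else a) * (if x 1 = 0 then 1 else b)) :
    kinDefect 2 (orthoTube 2 1 (fun e : Edge 3 2 => vecPart (g e.1 * (g (e.1.shift e.2))⁻¹))) (orthoTube 2 1 0) g = 0 := by
  rw [witness_orthoTube_eq ha hb hc hg, orthoTube_one_zero]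
  exact kinDefect_gaugeTransform_self 1 g

/-- The witness has ZERO Wilson action (it is a pure gauge) — it sits at the bottom of every action window. [folklore] -/
theorem witness_wilsonAction_eq_zero {a b : SU2} {φ : ℝ} (ha : su2Quat a = ⟨Real.cos φ, Real.sin φ, 0, 0⟩) (hb : su2Quat b = ⟨Real.cos φ, 0, Real.sin φ, 0⟩)
    (hc : 0 ≤ Real.cos φ) {g : Site 3 2 → SU2} (hg : ∀ x, g x = (if x 0 = 0 then 1 else a) * (if x 1 = 0 then 1 else b))
    {N : ℕ} (ρ : SU2 →* Matrix (Fin N) (Fin N) ℂ) :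
    wilsonAction ρ (orthoTube 2 1 (fun e : Edge 3 2 => vecPart (g e.1 * (g (e.1.shift e.2))⁻¹))) = 0 := by
  rw [witness_orthoTube_eq ha hb hc hg, wilsonAction_gaugeTransform, wilsonAction_one_eq_zero]

/-- The chart coordinates are honest: slow mean `1`, relative link vector `= linkEmbed x'`. [folklore] -/
theorem witness_coords {a b : SU2} {φ : ℝ} (ha : su2Quat a = ⟨Real.cos φ, Real.sin φ, 0, 0⟩) (hb : su2Quat b = ⟨Real.cos φ, 0, Real.sin φ, 0⟩)
    (hs : Real.sin φ ^ 2 ≤ 1 / 4) {g : Site 3 2 → SU2} (hg : ∀ x, g x = (if x 0 = 0 then 1 else a) * (if x 1 = 0 then 1 else b)) :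
    slowMean 2 (orthoTube 2 1 (fun e : Edge 3 2 => vecPart (g e.1 * (g (e.1.shift e.2))⁻¹))) = 1 ∧
      relLinkVec 2 (orthoTube 2 1 (fun e : Edge 3 2 => vecPart (g e.1 * (g (e.1.shift e.2))⁻¹))) =
        linkEmbed 2 (fun e : Edge 3 2 => vecPart (g e.1 * (g (e.1.shift e.2))⁻¹)) :=
  ⟨slowMean_orthoTube 2 1 (witness_mem_capBalancedSet ha hb hs hg), relLinkVec_orthoTube 2 1 (witness_mem_capBalancedSet ha hb hs hg)⟩

/-- ★ **The chart radius of the witness**: `‖x'‖² = 16 sin²φ` (`8` sites × `2` nontrivial directions × `sin²φ`). [folklore] -/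
theorem witness_norm_sq {a b : SU2} {φ : ℝ} (ha : su2Quat a = ⟨Real.cos φ, Real.sin φ, 0, 0⟩) (hb : su2Quat b = ⟨Real.cos φ, 0, Real.sin φ, 0⟩)
    {g : Site 3 2 → SU2} (hg : ∀ x, g x = (if x 0 = 0 then 1 else a) * (if x 1 = 0 then 1 else b)) :
    ‖linkEmbed 2 (fun e : Edge 3 2 => vecPart (g e.1 * (g (e.1.shift e.2))⁻¹))‖ ^ 2 = 16 * Real.sin φ ^ 2 := by
  rw [EuclideanSpace.real_norm_sq_eq, Fintype.sum_prod_type, Fintype.sum_prod_type]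
  simp only [linkEmbed_apply]
  have h : ∀ x : Site 3 2, ∑ k : Fin 3, ∑ c : Fin 3, vecPart (g x * (g (x.shift k))⁻¹) c ^ 2 = 2 * Real.sin φ ^ 2 := fun x => by
    simp only [witness_sum_sq ha hb hg, Fin.sum_univ_three, Fin.isValue]
    simp; ring
  simp only [h, Finset.sum_const, Finset.card_univ, nsmul_eq_mul]
  have hcard : Fintype.card (Site 3 2) = 8 := by simp
  rw [hcard]; push_cast; ring

/-- The `k`-component of `q_a q̄_b q̄_a`: `−2 cos φ sin²φ`. [folklore] -/
theorem witness_conj_quat {a b : SU2} {φ : ℝ} (ha : su2Quat a = ⟨Real.cos φ, Real.sin φ, 0, 0⟩) (hb : su2Quat b = ⟨Real.cos φ, 0, Real.sin φ, 0⟩) :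
    vecPart (a * b⁻¹ * a⁻¹) 2 = -2 * Real.cos φ * Real.sin φ ^ 2 := by
  have h : su2Quat (a * b⁻¹ * a⁻¹) = su2Quat a * star (su2Quat b) * star (su2Quat a) := by
    rw [Balaban1983to89.T4HaarSU2Translate.su2Quat_mul, Balaban1983to89.T4HaarSU2Translate.su2Quat_mul,
      Balaban1983to89.T4WilsonLinkAffine.su2Quat_inv, Balaban1983to89.T4WilsonLinkAffine.su2Quat_inv]
  have hK := congrArg QuaternionAlgebra.imK h
  rw [ha, hb] at hK
  show (su2Quat (a * b⁻¹ * a⁻¹)).imK = _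
  rw [hK]
  simp; ring

/-- Colour `2` of the witness vanishes on all direction-`0` links and on the direction-`1` link at the origin. [folklore] -/
theorem witness_col2_zero {a b : SU2} {φ : ℝ} (ha : su2Quat a = ⟨Real.cos φ, Real.sin φ, 0, 0⟩) (hb : su2Quat b = ⟨Real.cos φ, 0, Real.sin φ, 0⟩)
    {g : Site 3 2 → SU2} (hg : ∀ x, g x = (if x 0 = 0 then 1 else a) * (if x 1 = 0 then 1 else b)) :
    (∀ x : Site 3 2, vecPart (g x * (g (x.shift 0))⁻¹) 2 = 0) ∧ vecPart (g 0 * (g ((0 : Site 3 2).shift 1))⁻¹) 2 = 0 := by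
  have hKa : vecPart a 2 = 0 := by show (su2Quat a).imK = 0; rw [ha]
  have hKb : vecPart b 2 = 0 := by show (su2Quat b).imK = 0; rw [hb]
  refine ⟨fun x => ?_, ?_⟩
  · rw [witness_link0 hg]
    split_ifs
    · rw [vecPart_inv, Pi.neg_apply, hKa, neg_zero]
    · exact hKa
  · have e0 : (0 : Site 3 2) 0 = 0 := rfl
    have e1 : (0 : Site 3 2) 1 = 0 := rfl
    rw [witness_link1 hg, if_pos e0, if_pos e1, one_mul, inv_one, mul_one, vecPart_inv, Pi.neg_apply, hKb, neg_zero]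

/-- ★★ **One curl component of the witness**: `(d x')_{(0; 0<1), colour 2} = −2 cos φ sin²φ` — the chart field of a pure gauge is NOT curl-free beyond first order
(the BCH commutator of the two axis rotations). [folklore] -/
theorem witness_curl_component {a b : SU2} {φ : ℝ} (ha : su2Quat a = ⟨Real.cos φ, Real.sin φ, 0, 0⟩) (hb : su2Quat b = ⟨Real.cos φ, 0, Real.sin φ, 0⟩)
    {g : Site 3 2 → SU2} (hg : ∀ x, g x = (if x 0 = 0 then 1 else a) * (if x 1 = 0 then 1 else b)) :
    covCurl (1 : GaugeConfig 3 2 SU2) (linkEmbed 2 (fun e : Edge 3 2 => vecPart (g e.1 * (g (e.1.shift e.2))⁻¹)))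
        (((0 : Site 3 2), ⟨((0 : Fin 3), (1 : Fin 3)), by decide⟩), (2 : Fin 3)) = -2 * Real.cos φ * Real.sin φ ^ 2 := by
  rw [covCurl_one, latCurl_apply]
  simp only [linkEmbed_apply]
  obtain ⟨h0, h1⟩ := witness_col2_zero ha hb hg
  have h2 : vecPart (g ((0 : Site 3 2).shift 0) * (g (((0 : Site 3 2).shift 0).shift 1))⁻¹) 2 = -2 * Real.cos φ * Real.sin φ ^ 2 := by
    have h10 : (1 : ZMod 2) ≠ 0 := by decide
    rw [witness_link1 hg, shift_apply_two, shift_apply_two]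
    simp only [Pi.zero_apply, zero_add, Fin.isValue, if_true, one_ne_zero, if_false, h10]
    simpa using witness_conj_quat ha hb
  rw [h0, h0, h1, h2]; ring

/-- ★★★ **THE STIFF CHART COMPONENT OF THE WITNESS IS QUARTIC, NOT ZERO**: `‖P_s x'‖² ≥ sin⁴φ/32 = ‖x'‖⁴/8192` (`|sin φ| ≤ 1/2`). [folklore] -/
theorem witness_stiffProj_sq_ge {a b : SU2} {φ : ℝ} (ha : su2Quat a = ⟨Real.cos φ, Real.sin φ, 0, 0⟩) (hb : su2Quat b = ⟨Real.cos φ, 0, Real.sin φ, 0⟩)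
    (hs : Real.sin φ ^ 2 ≤ 1 / 4) {g : Site 3 2 → SU2} (hg : ∀ x, g x = (if x 0 = 0 then 1 else a) * (if x 1 = 0 then 1 else b)) :
    Real.sin φ ^ 4 / 32 ≤ ‖(stiffSpace 2).starProjection (linkEmbed 2 (fun e : Edge 3 2 => vecPart (g e.1 * (g (e.1.shift e.2))⁻¹)))‖ ^ 2 := by
  set v := linkEmbed 2 (fun e : Edge 3 2 => vecPart (g e.1 * (g (e.1.shift e.2))⁻¹)) with hv
  have h96 := R56.norm_covCurl_one_sq_le_stiffProj v
  have hcomp : (-2 * Real.cos φ * Real.sin φ ^ 2) ^ 2 ≤ ‖covCurl (1 : GaugeConfig 3 2 SU2) v‖ ^ 2 := by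
    rw [← witness_curl_component ha hb hg, EuclideanSpace.real_norm_sq_eq]
    exact Finset.single_le_sum (f := fun i => (covCurl (1 : GaugeConfig 3 2 SU2) v) i ^ 2) (fun i _ => sq_nonneg _) (Finset.mem_univ _)
  have hcs := Real.sin_sq_add_cos_sq φ
  nlinarith [sq_nonneg (Real.sin φ ^ 2)]

/-! ## §5 NEGATIVE: a stiff-separation inequality needs a slack `≥ c·‖x'‖⁴/8192` on gauge copies of the centre — it cannot hold on the whole chart ball, and on the
GAUGE-FAR far region (`‖x'‖ ~ β^{-s}`) the forced slack `~ β^{-4s}` exceeds `β^{-1}` for `s < 1/4` -/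

/-- ★★★ **NO SLACK-FREE STIFF SEPARATION on the chart ball** (`L = 2`): there is no `c > 0` with `kinDefect(oT 1 x', oT 1 x, g) ≥ c·‖P_s(x' − x)‖²` for all capped balanced
`x, x'` and all gauge fields `g` — the pure-gauge copies of the centre have zero defect and stiff component `≥ ‖x'‖⁴/8192 > 0`. [folklore] -/
theorem not_slackFree_stiffSeparation_two :
    ¬ ∃ c : ℝ, 0 < c ∧ ∀ (x x' : Edge 3 2 → Fin 3 → ℝ), x ∈ capBalancedSet 2 → x' ∈ capBalancedSet 2 → ∀ g : Site 3 2 → SU2,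
      c * ‖(stiffSpace 2).starProjection (linkEmbed 2 x' - linkEmbed 2 x)‖ ^ 2 ≤ kinDefect 2 (orthoTube 2 1 x') (orthoTube 2 1 x) g := by
  rintro ⟨c, hc, h⟩
  obtain ⟨a, ha⟩ := R8.exists_su2Quat_eq _ (R8.normSq_axisI (Real.pi / 6))
  obtain ⟨b, hb⟩ := R8.exists_su2Quat_eq _ (R8.normSq_axisJ (Real.pi / 6))
  have hsin : Real.sin (Real.pi / 6) = 1 / 2 := Real.sin_pi_div_six
  have hcos : 0 ≤ Real.cos (Real.pi / 6) := by rw [Real.cos_pi_div_six]; positivity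
  have hs : Real.sin (Real.pi / 6) ^ 2 ≤ 1 / 4 := by rw [hsin]; norm_num
  set g : Site 3 2 → SU2 := fun x => (if x 0 = 0 then 1 else a) * (if x 1 = 0 then 1 else b) with hgdef
  have hg : ∀ x, g x = (if x 0 = 0 then 1 else a) * (if x 1 = 0 then 1 else b) := fun x => rfl
  have hmem := witness_mem_capBalancedSet ha hb hs hg
  have hkin := witness_kinDefect_eq_zero ha hb hcos hg
  have hstiff := witness_stiffProj_sq_ge ha hb hs hg
  have h0 := h 0 _ (zero_mem_capBalancedSet 2) hmem g
  rw [hkin, map_zero, sub_zero] at h0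
  rw [hsin] at hstiff
  nlinarith

/-- ★★★ **THE FORCED SLACK** (tightness): if `kinDefect(oT 1 x', oT 1 x, g) ≥ c·‖P_s(x' − x)‖² − δ` holds for all capped balanced `x, x'` and all `g` (`c ≥ 0`), then
`δ ≥ c·sin⁴φ/32` for every `|sin φ| ≤ 1/2`, `cos φ ≥ 0` — i.e. `δ ≥ c·r⁴/8192` at chart radius `r = ‖x'‖ = 4|sin φ| ≤ 2` (`witness_norm_sq`). [folklore] -/
theorem slack_ge_of_stiffSeparation_two {c δ : ℝ} (hc : 0 ≤ c)
    (h : ∀ (x x' : Edge 3 2 → Fin 3 → ℝ), x ∈ capBalancedSet 2 → x' ∈ capBalancedSet 2 → ∀ g : Site 3 2 → SU2,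
      c * ‖(stiffSpace 2).starProjection (linkEmbed 2 x' - linkEmbed 2 x)‖ ^ 2 - δ ≤ kinDefect 2 (orthoTube 2 1 x') (orthoTube 2 1 x) g)
    {φ : ℝ} (hcos : 0 ≤ Real.cos φ) (hs : Real.sin φ ^ 2 ≤ 1 / 4) : c * Real.sin φ ^ 4 / 32 ≤ δ := by
  obtain ⟨a, ha⟩ := R8.exists_su2Quat_eq _ (R8.normSq_axisI φ)
  obtain ⟨b, hb⟩ := R8.exists_su2Quat_eq _ (R8.normSq_axisJ φ)
  set g : Site 3 2 → SU2 := fun x => (if x 0 = 0 then 1 else a) * (if x 1 = 0 then 1 else b) with hgdef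
  have hg : ∀ x, g x = (if x 0 = 0 then 1 else a) * (if x 1 = 0 then 1 else b) := fun x => rfl
  have hmem := witness_mem_capBalancedSet ha hb hs hg
  have hkin := witness_kinDefect_eq_zero ha hb hcos hg
  have hstiff := witness_stiffProj_sq_ge ha hb hs hg
  have h0 := h 0 _ (zero_mem_capBalancedSet 2) hmem g
  rw [hkin, map_zero, sub_zero] at h0
  nlinarith [mul_le_mul_of_nonneg_left hstiff hc]

/-- ★★ **THE WITNESS FAMILY, packaged** (every `φ` with `cos φ ≥ 0`, `sin²φ ≤ 1/4`): a capped balanced chart field `x'` and a gauge field `g` with `oT 1 x' = 1^g` (a pure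
gauge: zero action, zero kinetic defect against the centre, honest chart coordinates), chart radius `‖x'‖² = 16 sin²φ`, and stiff chart component
`‖P_s x'‖² ≥ ‖x'‖⁴/8192`. On lane A's GAUGE-FAR far region (`‖x'‖ ≍ β^{-s}`) this is a slack `≍ β^{-4s} ≫ β^{-1}` for `s < 1/4`: the stiff-separation step (d) of
COARSE-DESIGN §30.6 must stay restricted to GAUGE-NEAR `U` (there the same mechanism costs only `(β^{-1}ℓ)⁴`). [folklore] -/
theorem exists_pureGauge_witness_two {φ : ℝ} (hcos : 0 ≤ Real.cos φ) (hs : Real.sin φ ^ 2 ≤ 1 / 4) :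
    ∃ (x' : Edge 3 2 → Fin 3 → ℝ) (g : Site 3 2 → SU2), x' ∈ capBalancedSet 2 ∧ orthoTube 2 1 x' = gaugeTransform g 1 ∧
      kinDefect 2 (orthoTube 2 1 x') (orthoTube 2 1 0) g = 0 ∧ (∀ {N : ℕ} (ρ : SU2 →* Matrix (Fin N) (Fin N) ℂ), wilsonAction ρ (orthoTube 2 1 x') = 0) ∧
      slowMean 2 (orthoTube 2 1 x') = 1 ∧ relLinkVec 2 (orthoTube 2 1 x') = linkEmbed 2 x' ∧
      ‖linkEmbed 2 x'‖ ^ 2 = 16 * Real.sin φ ^ 2 ∧ ‖linkEmbed 2 x'‖ ^ 4 / 8192 ≤ ‖(stiffSpace 2).starProjection (linkEmbed 2 x')‖ ^ 2 := by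
  obtain ⟨a, ha⟩ := R8.exists_su2Quat_eq _ (R8.normSq_axisI φ)
  obtain ⟨b, hb⟩ := R8.exists_su2Quat_eq _ (R8.normSq_axisJ φ)
  set g : Site 3 2 → SU2 := fun x => (if x 0 = 0 then 1 else a) * (if x 1 = 0 then 1 else b) with hgdef
  have hg : ∀ x, g x = (if x 0 = 0 then 1 else a) * (if x 1 = 0 then 1 else b) := fun x => rfl
  obtain ⟨hsm, hrl⟩ := witness_coords ha hb hs hg
  refine ⟨_, g, witness_mem_capBalancedSet ha hb hs hg, witness_orthoTube_eq ha hb hcos hg, witness_kinDefect_eq_zero ha hb hcos hg,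
    fun ρ => witness_wilsonAction_eq_zero ha hb hcos hg ρ, hsm, hrl, witness_norm_sq ha hb hg, ?_⟩
  have h := witness_stiffProj_sq_ge ha hb hs hg
  have hn := witness_norm_sq ha hb hg
  have e : ‖linkEmbed 2 (fun e : Edge 3 2 => vecPart (g e.1 * (g (e.1.shift e.2))⁻¹))‖ ^ 4 =
      (‖linkEmbed 2 (fun e : Edge 3 2 => vecPart (g e.1 * (g (e.1.shift e.2))⁻¹))‖ ^ 2) ^ 2 := by ring
  rw [e, hn]
  nlinarith

end Summit.QuantumFields.YangMills.Theorems.TwistedTraceScaling.Negative.R56B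

end
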